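import Literature.Analysis.FluidPDE.TorusForcePotential
import Literature.Analysis.FluidPDE.DuchonRobertPressure
import Literature.Analysis.FluidPDE.WeakSolution
import Literature.Analysis.FunctionSpaces.TorusRieszTransformProofs
import HarnessLib

/-!
# The pressure of a forced weak solution on the flat torus: proof of `Torus.exists_pressure_of_isWeakNSSolutionForcedOn`

Analysis/FluidPDE proof file, sibling of `FluidPDE/WeakSolution`. It DISCHARGES the named fact
`Torus.exists_pressure_of_isWeakNSSolutionForcedOn` of that file (recovery of the pressure of a
*forced* weak solution of Navier–Stokes on `T^d × [0,T)`: if `u` is a forced pressure-free weak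
solution with datum, `u ∈ L^{2q}_{t,x}`, `f ∈ L^q_{t,x}` jointly measurable, `q > 1`, then there is
a pressure `p = (−Δ)⁻¹ div div (u ⊗ u) − (−Δ)⁻¹ div f ∈ L^q ⊂ L¹` making `(u, p)` a distributional
solution against all vector test fields; Robinson–Rodrigo–Sadowski 2016, Lemma 5.1 and Prop. 5.3;
Temam 1984, Ch. I Prop. 1.1–1.2 and Ch. III §1.5):

* `Torus.exists_pressure_of_isWeakNSSolutionForcedOn_of_CZ` — the fact for the index type `d` from the
  Calderón–Zygmund Hessian bound `Torus.eLpNorm_hessian_le_laplacian d`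
  (`FunctionSpaces/TorusRieszTransform`; Robinson–Rodrigo–Sadowski 2016, Thm. B.7);
* `Torus.exists_pressure_of_isWeakNSSolutionForcedOn_holds` — the discharge, for every finite index
  type `d`, by the tree's proof of that bound in every dimension
  (`Torus.eLpNorm_hessian_le_laplacian_holds`, `TorusRieszTransformProofs`, from the whole-space
  Calderón–Zygmund theory of `Literature/Analysis/SingularIntegrals/` and
  `FluidPDE/HessianLaplacianLpGeneralProofs`).

## The argument (Robinson–Rodrigo–Sadowski 2016, §5.1–5.2, on `T^d`, with a force)

1. **The pressure** (`Torus.exists_pressure_of_isWeakNSSolutionForcedOn_of_hessianBound`): for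
   `u ∈ L^{2q}((0,T) × T^d)` the velocity tensor `uᵢuⱼ` (`Torus.velTensor`) is in `L^q`
   (`|uᵢuⱼ| ≤ ‖u‖²`, `Torus.lintegral_velTensor_rpow_le_of_nonneg`), and `P₁` is the `L^q` limit of the
   approximate pressures of `FluidPDE/TorusPressurePoisson` (`Torus.exists_pressure` at `p = q`):
   jointly measurable, `∫∫|P₁|^q < ∞`, and for a.e. `t`, `∫ P₁(t)Δθ = -∑ᵢⱼ ∫ uᵢuⱼ(t) ∂ᵢ∂ⱼθ` for all
   smooth `θ` (RRS Lemma 5.1, (5.3)). The force components `fⱼ ∈ L^q` give `P₂ ∈ L^q` with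
   `∫ P₂(t)Δθ = -∑ⱼ ∫ fⱼ(t) ∂ⱼθ = -∫ ⟪f(t), ∇θ⟫` for a.e. `t` (`Torus.exists_forcePotential`,
   `FluidPDE/TorusForcePotential`). Both use the Calderón–Zygmund hypothesis `Torus.HessianBound d q C`.
   The pressure is `p = P₁ + P₂ ∈ L^q ⊂ L¹((0,T) × T^d)` (`Torus.lintegral_enorm_lt_top_of_lintegral_rpow`).
2. **Distributional solutions**
   (`Torus.IsWeakNSSolutionForcedOn.isDistributionalNSSolutionOn_of_pressure`, RRS Prop. 5.3 and its
   proof, with the force term): a test field `ψ` supported in `(0,T)` splits as `ψ = w + ∇φ`,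
   `φ = Δ⁻¹ div ψ` (`Torus.testPotential`), `w` divergence free, again a test field supported in
   `(0,T)` (`Torus.testSolenoidal`, from `FluidPDE/DuchonRobertPressure`) and vanishing at `t = 0`,
   so that the datum term `∫⟪u₀, w(0)⟫` of the forced weak formulation drops; `w` is admissible in
   the pressure-free weak formulation (force included), and the gradient part tests to zero
   slice-wise (`Torus.integral_gradientPart_eq_zero_forced`): `∂ₜ∇φ = ∇∂ₜφ` and `Δ∇φ = ∇Δφ` are
   gradients of smooth functions, killed by weak divergence-freeness, while
   `∫⟪u,(u·∇)∇φ⟫ = ∑ᵢⱼ∫uᵢuⱼ∂ᵢ∂ⱼφ` and `∫ ⟪f, ∇φ⟫` are exactly compensated by `∫ p Δφ` through the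
   weak Poisson equation `Δp = -∂ᵢ∂ⱼ(uᵢuⱼ) + div f`; `div ψ = Δφ` since `div w = 0`.
3. For an empty index type all fields vanish and the zero pressure does
   (`Torus.isDistributionalNSSolutionOn_zero_of_isEmpty_forced`).

The vendored statement generalises the printed one (RRS: `𝕋³`, `f = 0`, Leray–Hopf weak
solutions) to any finite index type, any `q > 1` and forces `f ∈ L^q_{t,x}` (Temam 1984, Ch. III
§1.5); the printed proof uses only the weak identity, the integrability `u ∈ L^{2q}`, and the
Calderón–Zygmund bound, and goes through verbatim — the statement was found faithful (not
mis-stated).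

## Mathlib / tree search

Mathlib (this pin): no Navier–Stokes notions, no Riesz transforms. Tree (reused, nothing
redefined): `FluidPDE/TorusPressurePoisson` (`Torus.exists_pressure`, `HessianBound`, `L^p` tools),
`FluidPDE/TorusForcePotential` (`Torus.exists_forcePotential`), `FluidPDE/DuchonRobertPressure`
(Helmholtz split of space–time test fields, `velTensor`, slice integrability, `hessianBound_of_fact`,
the unforced exponent-`3` precedent `Torus.IsWeakNSSolutionOn.isDistributionalNSSolutionOn_of_pressure`),
`FluidPDE/DuchonRobertInviscidLimit` (`(0,T) × T^d` glue), `FunctionSpaces/TorusRieszTransform(Proofs)`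
(the Calderón–Zygmund fact and its discharge in every dimension).

## References

* J. C. Robinson, J. L. Rodrigo, W. Sadowski, *The Three-Dimensional Navier–Stokes Equations:
  Classical Theory*, CUP 2016: §5.1, Lemma 5.1, (5.3)–(5.10) (book p. 88); §5.2, Prop. 5.3 and
  its proof (pp. 89–90); App. B, Thm. B.7 (pp. 385–386). [RobinsonRodrigoSadowskiCUP2016]
* R. Temam, *Navier–Stokes Equations. Theory and Numerical Analysis*, 3rd ed. (1984), Ch. I
  Prop. 1.1–1.2, Ch. III §1.5 (the pressure of forced weak solutions). [Temam1984]
-/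

noncomputable section

open MeasureTheory Set Filter Topology Function UnitAddTorus
open scoped ENNReal NNReal Convolution ContDiff InnerProductSpace

namespace Literature.Analysis.FluidPDE.Torus

open Literature.Analysis.FunctionSpaces Literature.Analysis.FunctionSpaces.Torus

/-! ## Slice tools: pairings of an integrable field with continuous fields

(`⟪g, V⟫ ∈ L¹(T^d)` for `g ∈ L¹`, `V` continuous is
`Literature.Analysis.FunctionSpaces.Torus.integrable_inner_of_continuous`, `FunctionSpaces/TorusFourierModes`.) -/

section SliceTools

variable {d : Type*} [Fintype d] [DecidableEq d]

omit [DecidableEq d] in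
/-- `gⱼ h ∈ L¹(T^d)` for `g ∈ L¹` (vector valued) and continuous scalar `h`. [folklore] -/
theorem integrable_coord_mul_continuous {g : UnitAddTorus d → EuclideanSpace ℝ d} (hg : Integrable g volume)
    (j : d) {h : UnitAddTorus d → ℝ} (hh : Continuous h) : Integrable (fun x => g x j * h x) volume := by
  have hgj : Integrable (fun x => g x j) volume :=
    (EuclideanSpace.proj j : EuclideanSpace ℝ d →L[ℝ] ℝ).integrable_comp hg
  obtain ⟨C, hC⟩ := exists_forall_norm_le_of_continuous hh
  exact hgj.mul_bdd hh.aestronglyMeasurable (ae_of_all _ hC)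

/-- `∫ ⟪g, ∇θ⟫ = ∑ⱼ ∫ gⱼ ∂ⱼθ` for `g ∈ L¹(T^d)` and smooth `θ`. [folklore] -/
theorem integral_inner_gradient_eq_sum {g : UnitAddTorus d → EuclideanSpace ℝ d} (hg : Integrable g volume)
    {θ : UnitAddTorus d → ℝ} (hθ : IsSmooth θ) :
    ∫ x, ⟪g x, Torus.gradient θ x⟫_ℝ = ∑ j, ∫ x, g x j * Torus.partialDeriv j θ x := by
  simp_rw [inner_gradient_eq_sum_mul_partialDeriv (hθ.isContDiff (by simp))]
  exact integral_finsetSum _ fun j _ => integrable_coord_mul_continuous hg j (hθ.partialDeriv j).continuous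

end SliceTools

/-! ## The gradient part of a test field against a forced weak solution with a very weak pressure -/

section Distributional

variable {d : Type*} [Fintype d] [DecidableEq d]

/-- **The gradient part of a test field tests to zero against `(u, P, f)`**: for `v ∈ L²(T^d)`
weakly divergence free, `g ∈ L¹(T^d)`, `q ∈ L¹(T^d)` solving `Δq = -∂ᵢ∂ⱼ(vᵢvⱼ) + div g` very
weakly, and a scalar `φ` with smooth space–time lift,
`∫ (⟪v, ∂ₜ∇φ⟫ + ⟪v, (v·∇)∇φ⟫ + ν⟪v, Δ∇φ⟫ + q Δφ + ⟪g, ∇φ⟫) dx = 0` at every time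
(`∂ₜ∇φ = ∇∂ₜφ`, `Δ∇φ = ∇Δφ` are gradients, killed by weak divergence-freeness;
`∫ ⟪v, (v·∇)∇φ⟫ = ∑ᵢⱼ ∫ vᵢvⱼ∂ᵢ∂ⱼφ`; Robinson–Rodrigo–Sadowski 2016, proof of Prop. 5.3, with a
force as in Temam 1984, Ch. III §1.5). [cite: RobinsonRodrigoSadowskiCUP2016, Prop. 5.3 (pp. 89–90)] -/
theorem integral_gradientPart_eq_zero_forced [Nonempty d] {φ : ℝ → UnitAddTorus d → ℝ} (hφ : ContDiff ℝ ∞ (stLift φ))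
    (ν : ℝ) {v : UnitAddTorus d → EuclideanSpace ℝ d} (hv : MemLp v 2 volume) (hdiv : Torus.IsWeaklyDivFree v)
    {g : UnitAddTorus d → EuclideanSpace ℝ d} (hg : Integrable g volume)
    {q : UnitAddTorus d → ℝ} (hq : Integrable q volume)
    (hPois : ∀ θ : UnitAddTorus d → ℝ, IsSmooth θ → ∫ x, q x * Torus.laplacian θ x =
      (-∑ i, ∑ j, ∫ x, (v x i * v x j) * Torus.partialDeriv i (Torus.partialDeriv j θ) x) -
        ∫ x, ⟪g x, Torus.gradient θ x⟫_ℝ) (t : ℝ) :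
    ∫ x, (⟪v x, Torus.timeDeriv (fun s => Torus.gradient (φ s)) t x⟫_ℝ +
        ⟪v x, Torus.convect v (Torus.gradient (φ t)) x⟫_ℝ +
        ν * ⟪v x, Torus.laplacian (Torus.gradient (φ t)) x⟫_ℝ + q x * Torus.laplacian (φ t) x +
        ⟪g x, Torus.gradient (φ t) x⟫_ℝ) = 0 := by
  have hφt : IsSmooth (φ t) := isSmooth_slice_of_contDiff hφ t
  have hφ' : IsSmooth (Torus.timeDeriv φ t) := isSmooth_slice_of_contDiff (contDiff_stLift_timeDeriv_of_contDiff hφ) t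
  -- the five terms
  have e1 : (fun x => ⟪v x, Torus.timeDeriv (fun s => Torus.gradient (φ s)) t x⟫_ℝ) =
      fun x => ⟪v x, Torus.gradient (Torus.timeDeriv φ t) x⟫_ℝ := by
    funext x; rw [timeDeriv_gradient_comm hφ t x]
  have e3 : (fun x => ν * ⟪v x, Torus.laplacian (Torus.gradient (φ t)) x⟫_ℝ) =
      fun x => ν * ⟪v x, Torus.gradient (Torus.laplacian (φ t)) x⟫_ℝ := by
    funext x; rw [laplacian_gradient hφt x]
  have e2 : (fun x => ⟪v x, Torus.convect v (Torus.gradient (φ t)) x⟫_ℝ) =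
      fun x => ∑ j, ∑ i, v x i * v x j * Torus.partialDeriv i (Torus.partialDeriv j (φ t)) x := by
    funext x
    rw [inner_convect_gradient hφt (v x) v x]
    refine Finset.sum_congr rfl fun j _ => Finset.sum_congr rfl fun i _ => ?_
    ring
  have hI1 : Integrable (fun x => ⟪v x, Torus.timeDeriv (fun s => Torus.gradient (φ s)) t x⟫_ℝ) volume := by
    rw [e1]; exact integrable_inner_continuous_of_memLp_two hv hφ'.gradient.continuous
  have hI2 : Integrable (fun x => ⟪v x, Torus.convect v (Torus.gradient (φ t)) x⟫_ℝ) volume :=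
    integrable_inner_convect_of_memLp_two hv (hφt.gradient.isContDiff (by simp))
  have hI3 : Integrable (fun x => ν * ⟪v x, Torus.laplacian (Torus.gradient (φ t)) x⟫_ℝ) volume := by
    rw [e3]; exact (integrable_inner_continuous_of_memLp_two hv hφt.laplacian.gradient.continuous).const_mul ν
  have hI4 : Integrable (fun x => q x * Torus.laplacian (φ t) x) volume := by
    obtain ⟨C, hC⟩ := exists_forall_norm_le_of_continuous hφt.laplacian.continuous
    exact hq.mul_bdd hφt.laplacian.continuous.aestronglyMeasurable (ae_of_all _ hC)
  have hI5 : Integrable (fun x => ⟪g x, Torus.gradient (φ t) x⟫_ℝ) volume :=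
    integrable_inner_of_continuous hg hφt.gradient.continuous
  have hI12 : Integrable (fun x => ⟪v x, Torus.timeDeriv (fun s => Torus.gradient (φ s)) t x⟫_ℝ +
      ⟪v x, Torus.convect v (Torus.gradient (φ t)) x⟫_ℝ) volume := hI1.add hI2
  have hI123 : Integrable (fun x => ⟪v x, Torus.timeDeriv (fun s => Torus.gradient (φ s)) t x⟫_ℝ +
      ⟪v x, Torus.convect v (Torus.gradient (φ t)) x⟫_ℝ +
      ν * ⟪v x, Torus.laplacian (Torus.gradient (φ t)) x⟫_ℝ) volume := hI12.add hI3
  have hI1234 : Integrable (fun x => ⟪v x, Torus.timeDeriv (fun s => Torus.gradient (φ s)) t x⟫_ℝ +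
      ⟪v x, Torus.convect v (Torus.gradient (φ t)) x⟫_ℝ +
      ν * ⟪v x, Torus.laplacian (Torus.gradient (φ t)) x⟫_ℝ + q x * Torus.laplacian (φ t) x) volume := hI123.add hI4
  rw [integral_add hI1234 hI5, integral_add hI123 hI4, integral_add hI12 hI3, integral_add hI1 hI2]
  -- values
  have v1 : ∫ x, ⟪v x, Torus.timeDeriv (fun s => Torus.gradient (φ s)) t x⟫_ℝ = 0 := by
    rw [e1]; exact hdiv _ hφ'
  have v3 : ∫ x, ν * ⟪v x, Torus.laplacian (Torus.gradient (φ t)) x⟫_ℝ = 0 := by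
    rw [e3, integral_const_mul, hdiv _ hφt.laplacian, mul_zero]
  set S : ℝ := ∑ j, ∑ i, ∫ x, v x i * v x j * Torus.partialDeriv i (Torus.partialDeriv j (φ t)) x with hS
  have hIij : ∀ i j, Integrable (fun x => v x i * v x j * Torus.partialDeriv i (Torus.partialDeriv j (φ t)) x)
      volume := fun i j =>
    integrable_coord_mul_coord_mul hv i j (((hφt.partialDeriv j).partialDeriv i).continuous)
  have v2 : ∫ x, ⟪v x, Torus.convect v (Torus.gradient (φ t)) x⟫_ℝ = S := by
    rw [e2, integral_finsetSum _ fun j _ => integrable_finsetSum _ fun i _ => hIij i j]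
    refine Finset.sum_congr rfl fun j _ => ?_
    rw [integral_finsetSum _ fun i _ => hIij i j]
  have v4 : ∫ x, q x * Torus.laplacian (φ t) x = -S - ∫ x, ⟪g x, Torus.gradient (φ t) x⟫_ℝ := by
    rw [hPois _ hφt, hS, Finset.sum_comm]
  rw [v1, v2, v3, v4]
  ring

variable {T ν : ℝ} {f u : ℝ → UnitAddTorus d → EuclideanSpace ℝ d} {u₀ : UnitAddTorus d → EuclideanSpace ℝ d}

omit [DecidableEq d] in
/-- Slices of the velocity of a forced weak solution are a.e. in `L²(T^d)`. [folklore] -/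
theorem ae_memLp_two_slice_of_isWeakNSSolutionForcedOn [DecidableEq d] (hu : IsWeakNSSolutionForcedOn T ν f u₀ u) :
    ∀ᵐ t ∂(volume.restrict (Ioo 0 T)), MemLp (u t) 2 volume := by
  have hm : AEStronglyMeasurable (uncurry u) ((volume.restrict (Ioo 0 T)).prod volume) :=
    aestronglyMeasurable_uncurry_prod hu.1
  have hfin : ∫⁻ z, ‖u z.1 z.2‖ₑ ^ (2 : ℝ) ∂((volume.restrict (Ioo 0 T)).prod volume) < ⊤ := by
    have h := hu.2.1
    rw [lintegral_Ioo_lintegral_eq_lintegral_prod (hm.enorm.pow_const _)] at h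
    simpa only [ENNReal.rpow_two] using h
  have h := ae_memLp_of_lintegral_prod_rpow_lt_top hm zero_lt_two hfin
  simpa only [ENNReal.ofReal_ofNat] using h

omit [Fintype d] [DecidableEq d] in
/-- Slices of an `L¹` vector field on `(0,T) × T^d` are a.e. integrable. [folklore] -/
theorem ae_integrable_slice_of_lintegral_vec [Fintype d] {g : ℝ → UnitAddTorus d → EuclideanSpace ℝ d}
    (hgm : AEStronglyMeasurable (uncurry g) ((volume.restrict (Ioo 0 T)).prod volume))
    (hg1 : ∫⁻ t in Ioo 0 T, ∫⁻ x, ‖g t x‖ₑ < ⊤) :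
    ∀ᵐ t ∂(volume.restrict (Ioo 0 T)), Integrable (g t) volume := by
  have hfin : ∫⁻ z, ‖g z.1 z.2‖ₑ ^ (1 : ℝ) ∂((volume.restrict (Ioo 0 T)).prod volume) < ⊤ := by
    rw [lintegral_Ioo_lintegral_eq_lintegral_prod hgm.enorm] at hg1
    simpa only [ENNReal.rpow_one] using hg1
  have h := ae_memLp_of_lintegral_prod_rpow_lt_top hgm zero_lt_one hfin
  filter_upwards [h] with t ht
  rw [ENNReal.ofReal_one] at ht
  exact memLp_one_iff_integrable.1 ht

/-- **Forced weak solutions with a very weak pressure are distributional solutions**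
(Robinson–Rodrigo–Sadowski 2016, Prop. 5.3, on `T^d`, with a force as in Temam 1984, Ch. III
§1.5): let `u` be a forced (pressure-free) weak Navier–Stokes/Euler solution on `T^d × [0,T)` with
force `f ∈ L¹((0,T) × T^d)` and datum `u₀` (`Torus.IsWeakNSSolutionForcedOn`: tested against
divergence-free fields), and let `P ∈ L¹((0,T) × T^d)` satisfy, for a.e. `t`,
`∫ P(t) Δθ = -∑ᵢⱼ ∫ uᵢuⱼ(t) ∂ᵢ∂ⱼθ - ∫ ⟪f(t), ∇θ⟫` for all smooth `θ` (very weak form of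
`ΔP = -∂ᵢ∂ⱼ(uᵢuⱼ) + div f`). Then `(u, P)` solves the forced equations against **all** smooth
vector test fields supported in `(0,T)` (`Torus.IsDistributionalNSSolutionOn`). Proof as printed:
split a test field `ψ = w + ∇φ`, `φ = Δ⁻¹div ψ` (`Torus.testPotential`), `w` divergence free
(`Torus.testSolenoidal`) and vanishing near `t = 0` (so the datum term drops); `w` is admissible in
the weak formulation, and the gradient part tests to zero slice-wise
(`integral_gradientPart_eq_zero_forced`). `d` nonempty. [cite: RobinsonRodrigoSadowskiCUP2016, Prop. 5.3 (pp. 89–90)] -/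
theorem _root_.Literature.Analysis.FluidPDE.Torus.IsWeakNSSolutionForcedOn.isDistributionalNSSolutionOn_of_pressure
    [Nonempty d] (hu : IsWeakNSSolutionForcedOn T ν f u₀ u)
    (hfm : AEStronglyMeasurable (uncurry f) ((volume.restrict (Ioo 0 T)).prod volume))
    (hf1 : ∫⁻ t in Ioo 0 T, ∫⁻ x, ‖f t x‖ₑ < ⊤) {P : ℝ → UnitAddTorus d → ℝ}
    (hPm : AEStronglyMeasurable (uncurry P) ((volume.restrict (Ioo 0 T)).prod volume))
    (hP1 : ∫⁻ t in Ioo 0 T, ∫⁻ x, ‖P t x‖ₑ < ⊤)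
    (hPweak : ∀ᵐ t ∂(volume.restrict (Ioo 0 T)), ∀ θ : UnitAddTorus d → ℝ, IsSmooth θ →
      ∫ x, P t x * Torus.laplacian θ x =
        (-∑ i, ∑ j, ∫ x, (u t x i * u t x j) * Torus.partialDeriv i (Torus.partialDeriv j θ) x) -
          ∫ x, ⟪f t x, Torus.gradient θ x⟫_ℝ) :
    IsDistributionalNSSolutionOn T ν f u P := by
  refine ⟨hu.1, hu.2.1, aestronglyMeasurable_stLift_of_uncurry hPm, hP1, hu.2.2.1, fun ψ hψ => ?_⟩
  have hψs : ContDiff ℝ ∞ (stLift ψ) := hψ.1.1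
  -- the decomposition
  set φ : ℝ → UnitAddTorus d → ℝ := testPotential ψ with hφ_def
  set w : ℝ → UnitAddTorus d → EuclideanSpace ℝ d := testSolenoidal ψ with hw_def
  have hφs : ContDiff ℝ ∞ (stLift φ) := contDiff_stLift_testPotential hψs
  have hΓs : ContDiff ℝ ∞ (stLift fun s => Torus.gradient (φ s)) := contDiff_stLift_gradient_testPotential hψs
  have hws : ContDiff ℝ ∞ (stLift w) := contDiff_stLift_testSolenoidal hψs
  have hwI : IsSpaceTimeTestIoo T w := isSpaceTimeTestIoo_testSolenoidal hψ
  have hw0 : (∫ t in Ioo 0 T, ∫ x, (⟪u t x, Torus.timeDeriv w t x⟫_ℝ + ⟪u t x, Torus.convect (u t) (w t) x⟫_ℝ +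
      ν * ⟪u t x, Torus.laplacian (w t) x⟫_ℝ + ⟪f t x, w t x⟫_ℝ)) = 0 := by
    have h := hu.2.2.2 w hwI.isSpaceTimeTest (isDivFreeTest_testSolenoidal hψs)
    have h0 : ∫ x, ⟪u₀ x, w 0 x⟫_ℝ = 0 := by
      simp [hwI.apply_zero]
    rwa [h0, add_zero] at h
  -- slices
  have hψt : ∀ t, IsSmooth (ψ t) := isSmooth_slice_of_contDiff hψs
  have hφt : ∀ t, IsSmooth (φ t) := isSmooth_slice_of_contDiff hφs
  have hwt : ∀ t, IsSmooth (w t) := isSmooth_slice_of_contDiff hws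
  -- pointwise identities
  have hw_apply : ∀ t x, w t x = ψ t x - Torus.gradient (φ t) x := fun t x => rfl
  have eT : ∀ t x, Torus.timeDeriv ψ t x =
      Torus.timeDeriv w t x + Torus.timeDeriv (fun s => Torus.gradient (φ s)) t x := by
    intro t x
    have hd1 : DifferentiableAt ℝ (fun s => ψ s x) t := differentiableAt_time_slice hψs t x
    have hd2 : DifferentiableAt ℝ (fun s => Torus.gradient (φ s) x) t := differentiableAt_time_slice hΓs t x
    have e : (fun s => w s x) = fun s => ψ s x - Torus.gradient (φ s) x := funext fun s => hw_apply s x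
    show deriv (fun s => ψ s x) t = deriv (fun s => w s x) t + deriv (fun s => Torus.gradient (φ s) x) t
    rw [e, deriv_fun_sub hd1 hd2]
    abel
  have eC : ∀ t x, Torus.convect (u t) (ψ t) x =
      Torus.convect (u t) (w t) x + Torus.convect (u t) (Torus.gradient (φ t)) x := by
    intro t x
    have e : w t = ψ t - Torus.gradient (φ t) := rfl
    simp only [Torus.convect]
    rw [e, fderiv_sub ((hψt t).isContDiff (by simp)) ((hφt t).gradient.isContDiff (by simp)),
      FunLike.coe_sub, Pi.sub_apply]
    abel
  have eL : ∀ t x, Torus.laplacian (ψ t) x =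
      Torus.laplacian (w t) x + Torus.laplacian (Torus.gradient (φ t)) x := by
    intro t x
    have e : w t = fun y => ψ t y - Torus.gradient (φ t) y := rfl
    rw [e, laplacian_fun_sub_apply (hψt t) (hφt t).gradient]
    abel
  have eD : ∀ t x, Torus.divergence (ψ t) x = Torus.laplacian (φ t) x := by
    intro t x
    have h0 := isDivFreeTest_testSolenoidal hψs t x
    have e : testSolenoidal ψ t = ψ t - Torus.gradient (φ t) := rfl
    rw [e, divergence_sub ((hψt t).isContDiff (by simp)) ((hφt t).gradient.isContDiff (by simp)),
      divergence_gradient_eq_laplacian (hφt t)] at h0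
    linarith
  have eF : ∀ t x, ⟪f t x, ψ t x⟫_ℝ = ⟪f t x, w t x⟫_ℝ + ⟪f t x, Torus.gradient (φ t) x⟫_ℝ := by
    intro t x
    rw [hw_apply, ← inner_add_right, sub_add_cancel]
  -- the integrand splits
  have hsplit : ∀ t x,
      ⟪u t x, Torus.timeDeriv ψ t x⟫_ℝ + ⟪u t x, Torus.convect (u t) (ψ t) x⟫_ℝ +
        ν * ⟪u t x, Torus.laplacian (ψ t) x⟫_ℝ + P t x * Torus.divergence (ψ t) x + ⟪f t x, ψ t x⟫_ℝ =
      (⟪u t x, Torus.timeDeriv w t x⟫_ℝ + ⟪u t x, Torus.convect (u t) (w t) x⟫_ℝ +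
        ν * ⟪u t x, Torus.laplacian (w t) x⟫_ℝ + ⟪f t x, w t x⟫_ℝ) +
      (⟪u t x, Torus.timeDeriv (fun s => Torus.gradient (φ s)) t x⟫_ℝ +
        ⟪u t x, Torus.convect (u t) (Torus.gradient (φ t)) x⟫_ℝ +
        ν * ⟪u t x, Torus.laplacian (Torus.gradient (φ t)) x⟫_ℝ + P t x * Torus.laplacian (φ t) x +
        ⟪f t x, Torus.gradient (φ t) x⟫_ℝ) := by
    intro t x
    rw [eT, eC, eL, eD, eF]
    simp only [inner_add_right]
    ring
  -- slice-wise: the gradient part integrates to zero and the `w` part is integrable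
  have hslice : ∀ᵐ t ∂(volume.restrict (Ioo 0 T)),
      ∫ x, (⟪u t x, Torus.timeDeriv ψ t x⟫_ℝ + ⟪u t x, Torus.convect (u t) (ψ t) x⟫_ℝ +
        ν * ⟪u t x, Torus.laplacian (ψ t) x⟫_ℝ + P t x * Torus.divergence (ψ t) x + ⟪f t x, ψ t x⟫_ℝ) =
      ∫ x, (⟪u t x, Torus.timeDeriv w t x⟫_ℝ + ⟪u t x, Torus.convect (u t) (w t) x⟫_ℝ +
        ν * ⟪u t x, Torus.laplacian (w t) x⟫_ℝ + ⟪f t x, w t x⟫_ℝ) := by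
    filter_upwards [ae_memLp_two_slice_of_isWeakNSSolutionForcedOn hu, hu.2.2.1,
      ae_integrable_slice_of_lintegral hPm hP1, ae_integrable_slice_of_lintegral_vec hfm hf1, hPweak]
      with t hu2 hdivt hPt hft hPoist
    simp_rw [hsplit t]
    have hwT : IsSmooth (Torus.timeDeriv w t) := isSmooth_slice_of_contDiff (contDiff_stLift_timeDeriv_of_contDiff hws) t
    have hIw : Integrable (fun x => ⟪u t x, Torus.timeDeriv w t x⟫_ℝ + ⟪u t x, Torus.convect (u t) (w t) x⟫_ℝ +
        ν * ⟪u t x, Torus.laplacian (w t) x⟫_ℝ + ⟪f t x, w t x⟫_ℝ) volume :=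
      (((integrable_inner_continuous_of_memLp_two hu2 hwT.continuous).add
        (integrable_inner_convect_of_memLp_two hu2 ((hwt t).isContDiff (by simp)))).add
        ((integrable_inner_continuous_of_memLp_two hu2 (hwt t).laplacian.continuous).const_mul ν)).add
        (integrable_inner_of_continuous hft (hwt t).continuous)
    have hΓT : IsSmooth (Torus.timeDeriv (fun s => Torus.gradient (φ s)) t) :=
      isSmooth_slice_of_contDiff (contDiff_stLift_timeDeriv_of_contDiff hΓs) t
    have hIq : Integrable (fun x => P t x * Torus.laplacian (φ t) x) volume := by
      obtain ⟨C, hC⟩ := exists_forall_norm_le_of_continuous (hφt t).laplacian.continuous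
      exact hPt.mul_bdd (hφt t).laplacian.continuous.aestronglyMeasurable (ae_of_all _ hC)
    have hIΓ : Integrable (fun x => ⟪u t x, Torus.timeDeriv (fun s => Torus.gradient (φ s)) t x⟫_ℝ +
        ⟪u t x, Torus.convect (u t) (Torus.gradient (φ t)) x⟫_ℝ +
        ν * ⟪u t x, Torus.laplacian (Torus.gradient (φ t)) x⟫_ℝ + P t x * Torus.laplacian (φ t) x +
        ⟪f t x, Torus.gradient (φ t) x⟫_ℝ) volume :=
      ((((integrable_inner_continuous_of_memLp_two hu2 hΓT.continuous).add
        (integrable_inner_convect_of_memLp_two hu2 ((hφt t).gradient.isContDiff (by simp)))).add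
        ((integrable_inner_continuous_of_memLp_two hu2 (hφt t).gradient.laplacian.continuous).const_mul ν)).add hIq).add
        (integrable_inner_of_continuous hft (hφt t).gradient.continuous)
    rw [integral_add hIw hIΓ, integral_gradientPart_eq_zero_forced hφs ν hu2 hdivt hft hPt hPoist t, add_zero]
  rw [integral_congr_ae hslice]
  exact hw0

end Distributional

/-! ## Exponent bookkeeping: `u ⊗ u ∈ L^q` from `u ∈ L^{2q}`, `L^q ⊂ L¹` on `(0,T) × T^d` -/

section Exponent

variable {d : Type*} [Fintype d]
variable {α : Type*} [MeasurableSpace α] {μ : Measure α}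

/-- `∫⁻ |uᵢuⱼ|^q ≤ ∫⁻ ‖u‖^{2q}` (`|uᵢuⱼ| ≤ ‖u‖²`, `q ≥ 0`). [folklore] -/
theorem lintegral_velTensor_rpow_le_of_nonneg (u : α → UnitAddTorus d → EuclideanSpace ℝ d) (i j : d) {q : ℝ}
    (hq : 0 ≤ q) :
    ∫⁻ z, ‖velTensor u i j z.1 z.2‖ₑ ^ q ∂(μ.prod volume) ≤ ∫⁻ z, ‖u z.1 z.2‖ₑ ^ (2 * q) ∂(μ.prod volume) := by
  refine lintegral_mono fun z => ?_
  calc ‖velTensor u i j z.1 z.2‖ₑ ^ q ≤ (‖u z.1 z.2‖ₑ ^ 2) ^ q := by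
        gcongr; exact enorm_velTensor_le u i j z.1 z.2
    _ = ‖u z.1 z.2‖ₑ ^ (2 * q) := by
        rw [← ENNReal.rpow_natCast, ← ENNReal.rpow_mul]; norm_num

variable {T : ℝ}

/-- `L^q ⊂ L¹` on the finite measure space `(0,T) × T^d`, `1 ≤ q`: a jointly measurable `P` with
`∫⁻ |P|^q < ∞` on the product has `∫₀ᵀ∫ |P| < ∞`. [folklore] -/
theorem lintegral_enorm_lt_top_of_lintegral_rpow {E : Type*} [NormedAddCommGroup E] {P : ℝ → UnitAddTorus d → E}
    (hPm : AEStronglyMeasurable (uncurry P) ((volume.restrict (Ioo 0 T)).prod volume)) {q : ℝ} (hq : 1 ≤ q)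
    (h : ∫⁻ z, ‖P z.1 z.2‖ₑ ^ q ∂((volume.restrict (Ioo 0 T)).prod volume) < ⊤) :
    ∫⁻ t in Ioo 0 T, ∫⁻ x, ‖P t x‖ₑ < ⊤ := by
  set μ2 := (volume.restrict (Ioo 0 T)).prod (volume : Measure (UnitAddTorus d)) with hμ2
  have hq0 : 0 < q := one_pos.trans_le hq
  set Q : ℝ≥0∞ := ENNReal.ofReal q with hQ
  have hQ1 : (1 : ℝ≥0∞) ≤ Q := by rw [hQ, ← ENNReal.ofReal_one]; exact ENNReal.ofReal_le_ofReal hq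
  have hQ0 : Q ≠ 0 := (zero_lt_one.trans_le hQ1).ne'
  have hQr : Q.toReal = q := ENNReal.toReal_ofReal hq0.le
  have hfin : eLpNorm (uncurry P) Q μ2 < ⊤ := by
    rw [eLpNorm_eq_lintegral_rpow_enorm_toReal hQ0 ENNReal.ofReal_ne_top, hQr]
    exact ENNReal.rpow_lt_top_of_nonneg (by positivity) h.ne
  have hle := eLpNorm_le_eLpNorm_mul_rpow_measure_univ (p := 1) (q := Q) hQ1 hPm (μ := μ2)
  have huniv : μ2 univ < ⊤ := by rw [hμ2, prod_Ioo_univ]; exact ENNReal.ofReal_lt_top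
  have h1 : eLpNorm (uncurry P) 1 μ2 < ⊤ :=
    hle.trans_lt (ENNReal.mul_lt_top hfin (ENNReal.rpow_lt_top_of_nonneg (by
      rw [hQr, ENNReal.toReal_one]; simp only [one_div, div_one, sub_nonneg]; exact inv_le_one_of_one_le₀ hq) huniv.ne))
  rw [eLpNorm_one_eq_lintegral_enorm] at h1
  rwa [lintegral_Ioo_lintegral_eq_lintegral_prod hPm.enorm]

end Exponent

/-! ## Assembly: the pressure of a forced weak solution -/

section Assembly

variable {d : Type*} [Fintype d] [DecidableEq d]
variable {T ν : ℝ} {f u : ℝ → UnitAddTorus d → EuclideanSpace ℝ d} {u₀ : UnitAddTorus d → EuclideanSpace ℝ d}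

/-- **The pressure of a forced weak solution, given the Calderón–Zygmund bound at one exponent**
(Robinson–Rodrigo–Sadowski 2016, Lemma 5.1 and Prop. 5.3; Temam 1984, Ch. III §1.5): if `u` is a
forced weak (pressure-free) solution on `T^d × [0,T)` with `u ∈ L^{2q}_{t,x}`, `f ∈ L^q_{t,x}`
(`1 < q`, `f` jointly measurable) and the Hessian bound `Torus.HessianBound d q C` holds, then
`p = P₁ + P₂` with `P₁` the `L^q` pressure of `u ⊗ u` (`Torus.exists_pressure`:
`ΔP₁ = -∂ᵢ∂ⱼ(uᵢuⱼ)` very weakly, a.e. in time) and `P₂` the `L^q` potential of `div f`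
(`Torus.exists_forcePotential`: `ΔP₂ = div f`) is in `L^q ⊂ L¹((0,T) × T^d)` and makes `(u, p)` a
distributional solution (`IsWeakNSSolutionForcedOn.isDistributionalNSSolutionOn_of_pressure`).
`d` nonempty. [cite: RobinsonRodrigoSadowskiCUP2016, Lemma 5.1 and Prop. 5.3 (pp. 88–90)] -/
theorem exists_pressure_of_isWeakNSSolutionForcedOn_of_hessianBound [Nonempty d] {q : ℝ} (hq : 1 < q) {C : ℝ≥0}
    (hC : HessianBound d (ENNReal.ofReal q) C) (h : IsWeakNSSolutionForcedOn T ν f u₀ u)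
    (hu : ∫⁻ t in Ioo 0 T, ∫⁻ x, ‖u t x‖ₑ ^ (2 * q) < ⊤)
    (hfm : AEStronglyMeasurable (stLift f) (volume.restrict (Ioo 0 T ×ˢ univ)))
    (hf : ∫⁻ t in Ioo 0 T, ∫⁻ x, ‖f t x‖ₑ ^ q < ⊤) :
    ∃ p : ℝ → UnitAddTorus d → ℝ, IsDistributionalNSSolutionOn T ν f u p := by
  set μ2 := (volume.restrict (Ioo 0 T)).prod (volume : Measure (UnitAddTorus d)) with hμ2
  have hq0 : 0 < q := one_pos.trans hq
  set Q : ℝ≥0∞ := ENNReal.ofReal q with hQ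
  have hQ1 : (1 : ℝ≥0∞) ≤ Q := by rw [hQ, ← ENNReal.ofReal_one]; exact ENNReal.ofReal_le_ofReal hq.le
  have hQt : Q ≠ ⊤ := ENNReal.ofReal_ne_top
  have hQ0 : Q ≠ 0 := (zero_lt_one.trans_le hQ1).ne'
  have hQr : Q.toReal = q := ENNReal.toReal_ofReal hq0.le
  -- measurability on the product
  have hum : AEStronglyMeasurable (uncurry u) μ2 := aestronglyMeasurable_uncurry_prod h.1
  have hfm' : AEStronglyMeasurable (uncurry f) μ2 := aestronglyMeasurable_uncurry_prod hfm
  -- the tensor data `u ⊗ u ∈ L^q`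
  have hGm : ∀ i j, AEStronglyMeasurable (uncurry (velTensor u i j)) μ2 := fun i j =>
    aestronglyMeasurable_uncurry_velTensor hum i j
  have hu' : ∫⁻ z, ‖u z.1 z.2‖ₑ ^ (2 * q) ∂μ2 < ⊤ := by
    have h' := hu
    rw [lintegral_Ioo_lintegral_eq_lintegral_prod (hum.enorm.pow_const _)] at h'
    exact h'
  have hGf : ∀ i j, ∫⁻ z, ‖velTensor u i j z.1 z.2‖ₑ ^ Q.toReal ∂μ2 < ⊤ := fun i j => by
    rw [hQr]
    exact (lintegral_velTensor_rpow_le_of_nonneg u i j hq0.le).trans_lt hu'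
  -- the force data `fⱼ ∈ L^q`
  set Fv : d → ℝ → UnitAddTorus d → ℝ := fun j t x => f t x j with hFv
  have hFm : ∀ j, AEStronglyMeasurable (uncurry (Fv j)) μ2 := fun j => aestronglyMeasurable_uncurry_coord hfm' j
  have hf' : ∫⁻ z, ‖f z.1 z.2‖ₑ ^ q ∂μ2 < ⊤ := by
    have h' := hf
    rw [lintegral_Ioo_lintegral_eq_lintegral_prod (hfm'.enorm.pow_const _)] at h'
    exact h'
  have hFf : ∀ j, ∫⁻ z, ‖Fv j z.1 z.2‖ₑ ^ Q.toReal ∂μ2 < ⊤ := fun j => by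
    rw [hQr]
    refine lt_of_le_of_lt (lintegral_mono fun z => ?_) hf'
    gcongr
    rw [← ofReal_norm, ← ofReal_norm]
    exact ENNReal.ofReal_le_ofReal (by simpa using PiLp.norm_apply_le (f z.1 z.2) j)
  -- the two halves of the pressure
  obtain ⟨P₁, hP₁m, hP₁b, -, hP₁w⟩ := exists_pressure (μ := volume.restrict (Ioo 0 T)) hQ1 hQt hC hGm hGf
  obtain ⟨P₂, hP₂m, hP₂b, hP₂w⟩ := exists_forcePotential (μ := volume.restrict (Ioo 0 T)) hQ1 hQt hC hFm hFf
  have hP₁f : ∫⁻ z, ‖P₁ z.1 z.2‖ₑ ^ Q.toReal ∂μ2 < ⊤ :=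
    hP₁b.trans_lt (ENNReal.mul_lt_top (presConst_lt_top hQ1 hQt)
      (ENNReal.sum_lt_top.2 fun i _ => ENNReal.sum_lt_top.2 fun j _ => hGf i j))
  have hP₂f : ∫⁻ z, ‖P₂ z.1 z.2‖ₑ ^ Q.toReal ∂μ2 < ⊤ :=
    hP₂b.trans_lt (ENNReal.mul_lt_top (forceConst_lt_top hQ1 hQt) (ENNReal.sum_lt_top.2 fun j _ => hFf j))
  -- the pressure
  set P : ℝ → UnitAddTorus d → ℝ := fun t x => P₁ t x + P₂ t x with hP_def
  have hPm : AEStronglyMeasurable (uncurry P) μ2 := hP₁m.add hP₂m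
  have hr1 : 1 ≤ Q.toReal := by rw [hQr]; exact hq.le
  have hPf : ∫⁻ z, ‖P z.1 z.2‖ₑ ^ Q.toReal ∂μ2 < ⊤ := by
    calc ∫⁻ z, ‖P z.1 z.2‖ₑ ^ Q.toReal ∂μ2
        ≤ ∫⁻ z, (2 : ℝ≥0∞) ^ (Q.toReal - 1) * (‖P₁ z.1 z.2‖ₑ ^ Q.toReal + ‖P₂ z.1 z.2‖ₑ ^ Q.toReal) ∂μ2 := by
          refine lintegral_mono fun z => ?_
          calc ‖P z.1 z.2‖ₑ ^ Q.toReal ≤ (‖P₁ z.1 z.2‖ₑ + ‖P₂ z.1 z.2‖ₑ) ^ Q.toReal := by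
                gcongr; exact enorm_add_le _ _
            _ ≤ _ := ENNReal.rpow_add_le_mul_rpow_add_rpow _ _ hr1
      _ < ⊤ := by
          have hm1 : AEMeasurable (fun z : ℝ × UnitAddTorus d => ‖P₁ z.1 z.2‖ₑ ^ Q.toReal) μ2 :=
            hP₁m.enorm.pow_const _
          rw [lintegral_const_mul' _ _ (ENNReal.rpow_ne_top_of_nonneg (by linarith) ENNReal.ofNat_ne_top),
            lintegral_add_left' hm1]
          exact ENNReal.mul_lt_top (ENNReal.rpow_lt_top_of_nonneg (by linarith) ENNReal.ofNat_ne_top)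
            (ENNReal.add_lt_top.2 ⟨hP₁f, hP₂f⟩)
  have hP1 : ∫⁻ t in Ioo 0 T, ∫⁻ x, ‖P t x‖ₑ < ⊤ := by
    rw [hQr] at hPf
    exact lintegral_enorm_lt_top_of_lintegral_rpow hPm hq.le hPf
  have hf1 : ∫⁻ t in Ioo 0 T, ∫⁻ x, ‖f t x‖ₑ < ⊤ :=
    lintegral_enorm_lt_top_of_lintegral_rpow hfm' hq.le hf'
  -- the very weak Poisson equation for `P`, a.e. in time
  have hP₁s : ∀ᵐ t ∂(volume.restrict (Ioo 0 T)), MemLp (P₁ t) Q volume :=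
    ae_memLp_slice_of_lintegral hQ0 hQt hP₁m hP₁f
  have hP₂s : ∀ᵐ t ∂(volume.restrict (Ioo 0 T)), MemLp (P₂ t) Q volume :=
    ae_memLp_slice_of_lintegral hQ0 hQt hP₂m hP₂f
  have hPweak : ∀ᵐ t ∂(volume.restrict (Ioo 0 T)), ∀ θ : UnitAddTorus d → ℝ, IsSmooth θ →
      ∫ x, P t x * Torus.laplacian θ x =
        (-∑ i, ∑ j, ∫ x, (u t x i * u t x j) * Torus.partialDeriv i (Torus.partialDeriv j θ) x) -
          ∫ x, ⟪f t x, Torus.gradient θ x⟫_ℝ := by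
    filter_upwards [hP₁w, hP₂w, hP₁s, hP₂s, ae_integrable_slice_of_lintegral_vec hfm' hf1]
      with t h1 h2 hs1 hs2 hft θ hθ
    obtain ⟨M, hM⟩ := exists_forall_norm_le_of_continuous hθ.laplacian.continuous
    have hI1 : Integrable (fun x => P₁ t x * Torus.laplacian θ x) volume :=
      (hs1.integrable hQ1).mul_bdd hθ.laplacian.continuous.aestronglyMeasurable (ae_of_all _ hM)
    have hI2 : Integrable (fun x => P₂ t x * Torus.laplacian θ x) volume :=
      (hs2.integrable hQ1).mul_bdd hθ.laplacian.continuous.aestronglyMeasurable (ae_of_all _ hM)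
    have e : (fun x => P t x * Torus.laplacian θ x) =
        fun x => P₁ t x * Torus.laplacian θ x + P₂ t x * Torus.laplacian θ x := by
      funext x; simp only [hP_def]; ring
    rw [e, integral_add hI1 hI2, h1 θ hθ, h2 θ hθ, integral_inner_gradient_eq_sum hft hθ]
    rfl
  exact ⟨P, h.isDistributionalNSSolutionOn_of_pressure hfm' hf1 hPm hP1 hPweak⟩

omit [DecidableEq d] in
/-- For an empty index type every vector of `ℝ^d` vanishes, and a forced weak solution is a
distributional solution with zero pressure. [folklore] -/
theorem isDistributionalNSSolutionOn_zero_of_isEmpty_forced [IsEmpty d] [DecidableEq d]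
    (h : IsWeakNSSolutionForcedOn T ν f u₀ u) : IsDistributionalNSSolutionOn T ν f u (fun _ _ => 0) := by
  refine ⟨h.1, h.2.1, aestronglyMeasurable_const, by simp, h.2.2.1, fun ψ hψ => ?_⟩
  have h0 : ∀ a : EuclideanSpace ℝ d, a = 0 := fun a => Subsingleton.elim a 0
  have hint : ∀ t x, ⟪u t x, Torus.timeDeriv ψ t x⟫_ℝ + ⟪u t x, Torus.convect (u t) (ψ t) x⟫_ℝ +
      ν * ⟪u t x, Torus.laplacian (ψ t) x⟫_ℝ + (0 : ℝ) * Torus.divergence (ψ t) x + ⟪f t x, ψ t x⟫_ℝ = 0 := by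
    intro t x
    rw [h0 (u t x), h0 (f t x)]
    simp
  simp_rw [hint, integral_zero]

/-- **The pressure of a forced weak solution on `T^d`, given the Calderón–Zygmund fact**
`Torus.eLpNorm_hessian_le_laplacian d` (Robinson–Rodrigo–Sadowski 2016, Thm. B.7): the named fact
`Torus.exists_pressure_of_isWeakNSSolutionForcedOn` of `FluidPDE/WeakSolution` (recovery of the
pressure `p = (−Δ)⁻¹ div div (u ⊗ u) − (−Δ)⁻¹ div f ∈ L^q ⊂ L¹` making `(u, p)` a distributional
solution; Robinson–Rodrigo–Sadowski 2016, Lemma 5.1 and Prop. 5.3; Temam 1984, Ch. I Prop. 1.1–1.2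
and Ch. III §1.5) holds for the index type `d` as soon as the Hessian bound holds on `T^d` at every
exponent. For empty `d` all fields vanish and the zero pressure does. [cite: RobinsonRodrigoSadowskiCUP2016, Lemma 5.1 and Prop. 5.3 (pp. 88–90)] -/
theorem exists_pressure_of_isWeakNSSolutionForcedOn_of_CZ (hCZ : eLpNorm_hessian_le_laplacian d) :
    exists_pressure_of_isWeakNSSolutionForcedOn (T := T) (ν := ν) (f := f) (u₀ := u₀) (u := u) := by
  intro h q hq hu hfm hf
  rcases isEmpty_or_nonempty d with hd | hd
  · exact ⟨fun _ _ => 0, isDistributionalNSSolutionOn_zero_of_isEmpty_forced h⟩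
  · have hQ1 : (1 : ℝ≥0∞) < ENNReal.ofReal q := by
      rw [← ENNReal.ofReal_one]; exact (ENNReal.ofReal_lt_ofReal_iff (one_pos.trans hq)).2 hq
    obtain ⟨C, hC⟩ := hessianBound_of_fact hCZ hQ1 ENNReal.ofReal_lt_top
    exact exists_pressure_of_isWeakNSSolutionForcedOn_of_hessianBound hq hC h hu hfm hf

/-- **Discharge of the named fact `Torus.exists_pressure_of_isWeakNSSolutionForcedOn`**
(`FluidPDE/WeakSolution`): recovery of the pressure of a forced weak solution of Navier–Stokes on
`T^d × [0,T)` — if `u` is a forced pressure-free weak solution with datum, `u ∈ L^{2q}_{t,x}`,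
`f ∈ L^q_{t,x}` jointly measurable, `q > 1`, then there is a pressure `p` (namely
`p = (−Δ)⁻¹ div div (u ⊗ u) − (−Δ)⁻¹ div f ∈ L^q ⊂ L¹`) making `(u, p)` a distributional solution
against all vector test fields (Robinson–Rodrigo–Sadowski 2016, Lemma 5.1 and Prop. 5.3; Temam
1984, Ch. I Prop. 1.1–1.2 and Ch. III §1.5). PROVED for every finite index type `d`: the
Calderón–Zygmund Hessian bound on `T^d` is the tree's `Torus.eLpNorm_hessian_le_laplacian_holds`
(`TorusRieszTransformProofs`; RRS Thm. B.7 from Stein 1970, III §1.3 Prop. 3 in every dimension),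
fed into `exists_pressure_of_isWeakNSSolutionForcedOn_of_CZ`. [cite: RobinsonRodrigoSadowskiCUP2016, Lemma 5.1 and Prop. 5.3 (pp. 88–90)] -/
theorem exists_pressure_of_isWeakNSSolutionForcedOn_holds :
    exists_pressure_of_isWeakNSSolutionForcedOn (T := T) (ν := ν) (f := f) (u₀ := u₀) (u := u) :=
  exists_pressure_of_isWeakNSSolutionForcedOn_of_CZ eLpNorm_hessian_le_laplacian_holds

end Assembly

end Literature.Analysis.FluidPDE.Torus
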